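import Mathlib
import Summits.ValiantsHypothesis.ValiantsHypothesis.Theorems.NewtonUnitEquationsTwoProductsTowerRecordLiftRealizable
import Summits.ValiantsHypothesis.ValiantsHypothesis.Theorems.NewtonUnitEquationsTwoProductsTowerRecordCarrierLaw
import Summits.ValiantsHypothesis.ValiantsHypothesis.Theorems.NewtonUnitEquationsTwoProductsMomentRecordLetters
import HarnessLib

/-!
# Size-mismatched additive coincidences lie outside the R12 and R13♯ hatches — for EVERY presentation

Negative lane, `--supports stmt-ValiantsHypothesis-5906` (route `NewtonUnitEquations`, crux `TwoProducts`, line `relation_ladder`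
v24/v25). No summit statement is proved here; VP ≠ VNP is NOT proved.

The v24 hatch (R12, `MomentRecord.CarrierDissociated`) and the v25 hatch (R13♯, `TowerRecord.TowerDissociatedE`) of
`ResidualLawV25` excuse an instance as soon as SOME presentation `(n, x, d[, E])` of its tail alphabet is dissociated.  This file gives
a PRESENTATION-FREE membership test for the complement: if the tail alphabet contains two letter families `a : ι → tailSupport`,
`b : κ → tailSupport` with the same sum `∑ a = ∑ b` but DIFFERENT sizes `|ι| ≠ |κ| ≤ m`, then NO presentation is realizable-dissociated
(`towerHatch_false_of_sizeMismatch`) and NO presentation is carrier-dissociated (`shiftedHatch_false_of_sizeMismatch`).  Reason: under any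
tower presentation `e = x_{i(e)} + j(e)•d` a family of `p` letters realises the pair `(S, k) = (Σ δ_{i(e)}, Σ j(e))` with `|S| = p` and
`k ∈ p·E` (`exists_realizable_of_presented`; `size_add_single` is ✓ `…MomentRecordLetters`' BY NAME); equal sums give equal planar points, and dissociation would force `S = S'`, hence `p = q`.

Smallest instances (both need only `2 ≤ m`): a DOUBLING PAIR `ℓ, 2ℓ ∈ tailSupport` (`{ℓ, ℓ}` vs `{2ℓ}`;
`towerHatch_false_of_double`, `shiftedHatch_false_of_double`) and an ADDITIVE TRIPLE `ℓ₁ + ℓ₂ = ℓ₃`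
(`towerHatch_false_of_add`, `shiftedHatch_false_of_add`).  Consequence for the line: every instance with a geometric tail letter pair
(`X^ℓ + X^{2ℓ}` in some factor, or across factors) is in the v25 residual class whatever `C` is — the two newest hatches do not touch it.
Same-size coincidences (`ℓ₁ + ℓ₂ = ℓ₃ + ℓ₄`) are NOT excluded presentation-free: the exchange relation `(x+d) + x' = x + (x'+d)` is
exactly what dissociation allows.

FIRST INSTANCE (A₂): `m = 2`, a letter `ℓ` (e.g. a `(1,·)`-type letter of a digit table) with `2ℓ` again a letter — the carry `ℓ + ℓ = 2ℓ`.
READING (val-idea-crit-8 g4, PRE-PRICE 2026-08-29T04:55:39Z, the informal understanding of record made kernel): «the R13♯/R12 hatches contain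
no alphabet with a carry; every digit-grid (γ1) table (two consecutive digits `2^i σ, 2^{i+1} σ` both letters) sits in the v25 residual» — for
every `C`.  HONEST LABEL: bookkeeping / membership criterion on the Negative lane; NOT a refutation, NOT «the hatch is empty» (carry-free
dissociated towers remain in it), 0 distance on `ResidualLawV25` / `PlanarCellBound` / `stub_residual`.  Both conclusion shapes are given:
the hatch existentials of `ResidualLawV25` negated verbatim (`towerHatch_false_…`, `shiftedHatch_false_…`) and the literal
`∀ n x d E, TowerAlphabet u v x d E → ¬ TowerDissociatedE x d m E` / `shiftZ`-twin (`towerAlphabet_not_dissociatedE_of_sizeMismatch`,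
`shiftedAlphabet_not_carrierDissociated_of_sizeMismatch`). [folklore]
-/

set_option linter.dupNamespace false

open scoped BigOperators
open Summit.ValiantsHypothesis.ValiantsHypothesis.Theorems.NewtonUnitEquations.TwoProducts.FormalLogLinearisation
open Summit.ValiantsHypothesis.ValiantsHypothesis.Theorems.NewtonUnitEquations.TwoProducts.PlanarCell
open Summit.ValiantsHypothesis.ValiantsHypothesis.Theorems.NewtonUnitEquations.TwoProducts.MomentRecord
open Summit.ValiantsHypothesis.ValiantsHypothesis.Theorems.NewtonUnitEquations.TwoProducts.TowerRecord
open Summit.ValiantsHypothesis.ValiantsHypothesis.Theorems.NewtonUnitEquations.TwoProducts.TowerRecord.Lift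

namespace Summit.ValiantsHypothesis.ValiantsHypothesis.Theorems.NewtonUnitEquations.TwoProducts.Negative.SizeMismatch

variable {m n : ℕ}

/-! ## Realising a presented letter family as a pair `(S, k)` -/

/-- Adding one letter `x_i + j•d`: the planar point moves by that letter. [folklore] -/
theorem ptZ_add_single (x : Fin n → Expo) (d : Fin 2 → ℤ) (S : Fin n → ℕ) (k : ℕ) (i : Fin n) (j : ℕ) (c : Fin 2) :
    ptZ x d (S + Pi.single i 1) (k + j) c = ptZ x d S k c + (((x i c : ℕ) : ℤ) + (j : ℤ) * d c) := by
  classical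
  simp only [ptZ, Pi.add_apply, Nat.cast_add, add_mul, Finset.sum_add_distrib]
  have h : ∑ l : Fin n, (((Pi.single i (1 : ℕ) : Fin n → ℕ) l : ℕ) : ℤ) * ((x l c : ℕ) : ℤ) = ((x i c : ℕ) : ℤ) := by
    rw [Finset.sum_eq_single i]
    · simp
    · intro l _ hl
      simp [hl]
    · intro hi
      exact absurd (Finset.mem_univ i) hi
  rw [h]
  ring

/-- A finite family of letters, each presented as `x_i + j•d` with `j ∈ E`, realises a pair `(S, k)` with `|S| = #family`,
`k ∈ |S|·E` and planar point the sum of the family. [folklore] -/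
theorem exists_realizable_of_presented {ι : Type*} (x : Fin n → Expo) (d : Fin 2 → ℤ) (E : Finset ℕ) (a : ι → Expo)
    (ha : ∀ r, ∃ i : Fin n, ∃ j ∈ E, ∀ c, ((a r c : ℕ) : ℤ) = ((x i c : ℕ) : ℤ) + (j : ℤ) * d c) (s : Finset ι) :
    ∃ (S : Fin n → ℕ) (k : ℕ), size S = s.card ∧ k ∈ sumset E (size S) ∧
      ∀ c, ptZ x d S k c = ∑ r ∈ s, ((a r c : ℕ) : ℤ) := by
  classical
  induction s using Finset.induction_on with
  | empty =>
    refine ⟨0, 0, by simp [size], ?_, fun c => by simp [ptZ]⟩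
    have h0 : size (0 : Fin n → ℕ) = 0 := by simp [size]
    rw [h0]
    exact zero_mem_sumset_zero E
  | insert r s hr ih =>
    obtain ⟨S, k, hS, hk, hpt⟩ := ih
    obtain ⟨i, j, hj, hc⟩ := ha r
    refine ⟨S + Pi.single i 1, k + j, ?_, ?_, ?_⟩
    · rw [size_add_single, hS, Finset.card_insert_of_notMem hr]
    · rw [size_add_single]
      exact add_mem_sumset_succ hk hj
    · intro c
      rw [ptZ_add_single, hpt, ← hc, Finset.sum_insert hr, add_comm]

/-! ## The presentation-free criterion -/

/-- **SIZE MISMATCH ⇒ NOT REALIZABLE-DISSOCIATED (any presentation).**  Two presented letter families with equal sums and different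
sizes `≤ m` violate `TowerDissociatedE x d m E`. [folklore] -/
theorem not_towerDissociatedE_of_sizeMismatch {ι κ : Type*} [Fintype ι] [Fintype κ] (x : Fin n → Expo) (d : Fin 2 → ℤ)
    (E : Finset ℕ) (a : ι → Expo) (b : κ → Expo)
    (ha : ∀ r, ∃ i : Fin n, ∃ j ∈ E, ∀ c, ((a r c : ℕ) : ℤ) = ((x i c : ℕ) : ℤ) + (j : ℤ) * d c)
    (hb : ∀ r, ∃ i : Fin n, ∃ j ∈ E, ∀ c, ((b r c : ℕ) : ℤ) = ((x i c : ℕ) : ℤ) + (j : ℤ) * d c)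
    (hsum : ∑ r, a r = ∑ r, b r) (hne : Fintype.card ι ≠ Fintype.card κ)
    (hι : Fintype.card ι ≤ m) (hκ : Fintype.card κ ≤ m) :
    ¬ TowerDissociatedE x d m E := by
  classical
  intro hdis
  obtain ⟨S, k, hS, hk, hpt⟩ := exists_realizable_of_presented x d E a ha Finset.univ
  obtain ⟨S', k', hS', hk', hpt'⟩ := exists_realizable_of_presented x d E b hb Finset.univ
  rw [Finset.card_univ] at hS hS'
  have heq : ptZ x d S k = ptZ x d S' k' := by
    funext c
    rw [hpt c, hpt' c]
    have h := congrArg (fun e : Expo => ((e c : ℕ) : ℤ)) hsum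
    simpa [Finsupp.finsetSum_apply] using h
  have h1 := (hdis S S' k k' (hS ▸ hι) (hS' ▸ hκ) hk hk' heq).1
  exact hne (by rw [← hS, ← hS', h1])

/-- **SIZE MISMATCH ⇒ NOT CARRIER-DISSOCIATED (any presentation)** — the R12 form: letters presented inside `X ⊔ (X + d)`. [folklore] -/
theorem not_carrierDissociated_of_sizeMismatch {ι κ : Type*} [Fintype ι] [Fintype κ] (x : Fin n → Expo) (d : Fin 2 → ℤ)
    (a : ι → Expo) (b : κ → Expo)
    (ha : ∀ r, ∃ i : Fin n, a r = x i ∨ ∀ c, ((a r c : ℕ) : ℤ) = shiftZ x d i c)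
    (hb : ∀ r, ∃ i : Fin n, b r = x i ∨ ∀ c, ((b r c : ℕ) : ℤ) = shiftZ x d i c)
    (hsum : ∑ r, a r = ∑ r, b r) (hne : Fintype.card ι ≠ Fintype.card κ)
    (hι : Fintype.card ι ≤ m) (hκ : Fintype.card κ ≤ m) :
    ¬ CarrierDissociated x d m := by
  intro hdis
  have hE : ∀ j ∈ Finset.range 2, j ≤ 1 := fun j hj => by
    have := Finset.mem_range.mp hj
    omega
  have conv : ∀ e : Expo, (∃ i : Fin n, e = x i ∨ ∀ c, ((e c : ℕ) : ℤ) = shiftZ x d i c) →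
      ∃ i : Fin n, ∃ j ∈ Finset.range 2, ∀ c, ((e c : ℕ) : ℤ) = ((x i c : ℕ) : ℤ) + (j : ℤ) * d c := by
    rintro e ⟨i, h | h⟩
    · exact ⟨i, 0, by simp, fun c => by rw [h]; simp⟩
    · exact ⟨i, 1, by simp, fun c => by rw [h c, shiftZ]; simp⟩
  exact not_towerDissociatedE_of_sizeMismatch x d (Finset.range 2) a b (fun r => conv _ (ha r)) (fun r => conv _ (hb r))
    hsum hne hι hκ (towerDissociatedE_of_towerDissociated hE ((towerDissociated_one_iff x d m).mpr hdis))

/-! ## The two hatches of `ResidualLawV25`, verbatim, fail on size-mismatched alphabets -/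

/-- **The v25 hatch (R13♯) is empty on size-mismatched alphabets**: with two tail-letter families of equal sum and different sizes `≤ m`,
`¬ ∃ n x d E, TowerAlphabet u v x d E ∧ TowerDissociatedE x d m E` — the hypothesis of `ResidualLawV25` holds automatically. [folklore] -/
theorem towerHatch_false_of_sizeMismatch {ι κ : Type*} [Fintype ι] [Fintype κ] {u v : Fin m → MvPolynomial (Fin 2) ℂ}
    (a : ι → Expo) (b : κ → Expo) (haT : ∀ r, a r ∈ tailSupport u v) (hbT : ∀ r, b r ∈ tailSupport u v)
    (hsum : ∑ r, a r = ∑ r, b r) (hne : Fintype.card ι ≠ Fintype.card κ)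
    (hι : Fintype.card ι ≤ m) (hκ : Fintype.card κ ≤ m) :
    ¬ ∃ (n : ℕ) (x : Fin n → Expo) (d : Fin 2 → ℤ) (E : Finset ℕ),
        TowerAlphabet u v x d E ∧ TowerDissociatedE x d m E := by
  rintro ⟨n, x, d, E, hA, hdis⟩
  exact not_towerDissociatedE_of_sizeMismatch x d E a b (fun r => hA _ (haT r)) (fun r => hA _ (hbT r)) hsum hne hι hκ hdis

/-- **The v24 hatch (R12) is empty on size-mismatched alphabets**: same hypotheses,
`¬ ∃ n x d, (alphabet ⊆ X ⊔ (X+d)) ∧ CarrierDissociated x d m`. [folklore] -/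
theorem shiftedHatch_false_of_sizeMismatch {ι κ : Type*} [Fintype ι] [Fintype κ] {u v : Fin m → MvPolynomial (Fin 2) ℂ}
    (a : ι → Expo) (b : κ → Expo) (haT : ∀ r, a r ∈ tailSupport u v) (hbT : ∀ r, b r ∈ tailSupport u v)
    (hsum : ∑ r, a r = ∑ r, b r) (hne : Fintype.card ι ≠ Fintype.card κ)
    (hι : Fintype.card ι ≤ m) (hκ : Fintype.card κ ≤ m) :
    ¬ ∃ (n : ℕ) (x : Fin n → Expo) (d : Fin 2 → ℤ),
        (∀ e ∈ tailSupport u v, ∃ i, e = x i ∨ ∀ c, ((e c : ℕ) : ℤ) = shiftZ x d i c) ∧ CarrierDissociated x d m := by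
  rintro ⟨n, x, d, hA, hdis⟩
  exact not_carrierDissociated_of_sizeMismatch x d a b (fun r => hA _ (haT r)) (fun r => hA _ (hbT r)) hsum hne hι hκ hdis

/-- **Literal form (crit-8 TERMS (ii))**: for EVERY presentation, a tower alphabet carrying a size-mismatched coincidence is not
realizable-dissociated. [folklore] -/
theorem towerAlphabet_not_dissociatedE_of_sizeMismatch {ι κ : Type*} [Fintype ι] [Fintype κ] {u v : Fin m → MvPolynomial (Fin 2) ℂ}
    (a : ι → Expo) (b : κ → Expo) (haT : ∀ r, a r ∈ tailSupport u v) (hbT : ∀ r, b r ∈ tailSupport u v)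
    (hsum : ∑ r, a r = ∑ r, b r) (hne : Fintype.card ι ≠ Fintype.card κ)
    (hι : Fintype.card ι ≤ m) (hκ : Fintype.card κ ≤ m) :
    ∀ (n : ℕ) (x : Fin n → Expo) (d : Fin 2 → ℤ) (E : Finset ℕ), TowerAlphabet u v x d E → ¬ TowerDissociatedE x d m E :=
  fun _ x d E hA => not_towerDissociatedE_of_sizeMismatch x d E a b (fun r => hA _ (haT r)) (fun r => hA _ (hbT r)) hsum hne hι hκ

/-- **Literal form, R12 twin**: for EVERY presentation inside `X ⊔ (X+d)`, a size-mismatched coincidence kills carrier dissociation. [folklore] -/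
theorem shiftedAlphabet_not_carrierDissociated_of_sizeMismatch {ι κ : Type*} [Fintype ι] [Fintype κ]
    {u v : Fin m → MvPolynomial (Fin 2) ℂ}
    (a : ι → Expo) (b : κ → Expo) (haT : ∀ r, a r ∈ tailSupport u v) (hbT : ∀ r, b r ∈ tailSupport u v)
    (hsum : ∑ r, a r = ∑ r, b r) (hne : Fintype.card ι ≠ Fintype.card κ)
    (hι : Fintype.card ι ≤ m) (hκ : Fintype.card κ ≤ m) :
    ∀ (n : ℕ) (x : Fin n → Expo) (d : Fin 2 → ℤ),
      (∀ e ∈ tailSupport u v, ∃ i, e = x i ∨ ∀ c, ((e c : ℕ) : ℤ) = shiftZ x d i c) → ¬ CarrierDissociated x d m :=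
  fun _ x d hA => not_carrierDissociated_of_sizeMismatch x d a b (fun r => hA _ (haT r)) (fun r => hA _ (hbT r)) hsum hne hι hκ

/-! ## Smallest instances: a doubling pair, an additive triple -/

/-- **DOUBLING PAIR ⇒ outside the v25 hatch**: `ℓ, 2ℓ ∈ tailSupport u v` and `2 ≤ m` ⇒ no realizable-dissociated tower presentation. [folklore] -/
theorem towerHatch_false_of_double {u v : Fin m → MvPolynomial (Fin 2) ℂ} (hm : 2 ≤ m) (ℓ : Expo)
    (h1 : ℓ ∈ tailSupport u v) (h2 : 2 • ℓ ∈ tailSupport u v) :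
    ¬ ∃ (n : ℕ) (x : Fin n → Expo) (d : Fin 2 → ℤ) (E : Finset ℕ),
        TowerAlphabet u v x d E ∧ TowerDissociatedE x d m E :=
  towerHatch_false_of_sizeMismatch (ι := Fin 2) (κ := Fin 1) (fun _ => ℓ) (fun _ => 2 • ℓ) (fun _ => h1) (fun _ => h2)
    (by simp) (by simp) (by simpa using hm) (by simp; omega)

/-- **DOUBLING PAIR ⇒ outside the v24 hatch**. [folklore] -/
theorem shiftedHatch_false_of_double {u v : Fin m → MvPolynomial (Fin 2) ℂ} (hm : 2 ≤ m) (ℓ : Expo)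
    (h1 : ℓ ∈ tailSupport u v) (h2 : 2 • ℓ ∈ tailSupport u v) :
    ¬ ∃ (n : ℕ) (x : Fin n → Expo) (d : Fin 2 → ℤ),
        (∀ e ∈ tailSupport u v, ∃ i, e = x i ∨ ∀ c, ((e c : ℕ) : ℤ) = shiftZ x d i c) ∧ CarrierDissociated x d m :=
  shiftedHatch_false_of_sizeMismatch (ι := Fin 2) (κ := Fin 1) (fun _ => ℓ) (fun _ => 2 • ℓ) (fun _ => h1) (fun _ => h2)
    (by simp) (by simp) (by simpa using hm) (by simp; omega)

/-- **ADDITIVE TRIPLE ⇒ outside the v25 hatch**: `ℓ₁, ℓ₂, ℓ₁ + ℓ₂ ∈ tailSupport u v`, `2 ≤ m`. [folklore] -/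
theorem towerHatch_false_of_add {u v : Fin m → MvPolynomial (Fin 2) ℂ} (hm : 2 ≤ m) (ℓ₁ ℓ₂ : Expo)
    (h1 : ℓ₁ ∈ tailSupport u v) (h2 : ℓ₂ ∈ tailSupport u v) (h12 : ℓ₁ + ℓ₂ ∈ tailSupport u v) :
    ¬ ∃ (n : ℕ) (x : Fin n → Expo) (d : Fin 2 → ℤ) (E : Finset ℕ),
        TowerAlphabet u v x d E ∧ TowerDissociatedE x d m E :=
  towerHatch_false_of_sizeMismatch (ι := Fin 2) (κ := Fin 1) ![ℓ₁, ℓ₂] (fun _ => ℓ₁ + ℓ₂)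
    (fun r => by fin_cases r <;> simpa) (fun _ => h12)
    (by simp [Fin.sum_univ_two]) (by simp) (by simpa using hm) (by simp; omega)

/-- **ADDITIVE TRIPLE ⇒ outside the v24 hatch**. [folklore] -/
theorem shiftedHatch_false_of_add {u v : Fin m → MvPolynomial (Fin 2) ℂ} (hm : 2 ≤ m) (ℓ₁ ℓ₂ : Expo)
    (h1 : ℓ₁ ∈ tailSupport u v) (h2 : ℓ₂ ∈ tailSupport u v) (h12 : ℓ₁ + ℓ₂ ∈ tailSupport u v) :
    ¬ ∃ (n : ℕ) (x : Fin n → Expo) (d : Fin 2 → ℤ),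
        (∀ e ∈ tailSupport u v, ∃ i, e = x i ∨ ∀ c, ((e c : ℕ) : ℤ) = shiftZ x d i c) ∧ CarrierDissociated x d m :=
  shiftedHatch_false_of_sizeMismatch (ι := Fin 2) (κ := Fin 1) ![ℓ₁, ℓ₂] (fun _ => ℓ₁ + ℓ₂)
    (fun r => by fin_cases r <;> simpa) (fun _ => h12)
    (by simp [Fin.sum_univ_two]) (by simp) (by simpa using hm) (by simp; omega)

end Summit.ValiantsHypothesis.ValiantsHypothesis.Theorems.NewtonUnitEquations.TwoProducts.Negative.SizeMismatch
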